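import Summits.AtomisticToContinuum.FouriersLaw.Theorems.BondHeatUncertaintyExtensiveSnapshotIrreversibilityEnergyWindowSkeletonSecondVariation
import Summits.AtomisticToContinuum.FouriersLaw.Theorems.BondHeatUncertaintyExtensiveSnapshotIrreversibilityEnergyWindowSkeletonJacobianMoments

/-!
# Energy window, part V-c — (JMˣ)₂ `SkeletonSecondVariationMoments` PROVED

Lineage `stmt-AtomisticToContinuum-9121` (`ExtensiveSnapshotIrreversibility`), K_fix half, leaf S3
`KernelTemperatureLipschitz`; (G1*ᶜᶜ) ⟸ (SWM)ₐ ∧ (JMˣ)₁✓ ∧ (JMˣ)₂, (G1ℓ) ⟸ (SWM)_d ∧ (JM)✓ ∧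
(JMˣ)₁✓ ∧ (JMˣ)₂ (critic row 1107).  Cell decomp-a2c, lens «grading / quantitative ladder»,
generation 80, part V «SkeletonSecondVariation»: V-a `…ForcedSecondVariation` · V-b1
`…DriftSecondDerivative` · V-b2 `…SkeletonSecondVariation` · V-c (this file; imports V-b2 and
T-a2 `…SkeletonJacobianMoments`).

THIS FILE closes the leaf (JMˣ)₂ = T-a1's `SkeletonSecondVariationMoments` (§6 of
`…EnergyWindowSkeletonVariation`, signature VERBATIM, BC7 CLEAN in g79):
* `lintegral_rpow_norm_fderiv_fderiv_skelFlowMapAt_le` — V-b2's pathwise bound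
  `‖D²_x X_s^{m}[δ, δ']‖ ≤ Amp²|δ||δ'| exp ∫₀ˢ(3A₀ + (3A₁ + B₁)√H)` fed into T-a2's moment engine
  `lintegral_rpow_le_of_le_mul_exp_integral` (Young + Jensen in time + Tonelli + the fixed-time
  exponential moment CEHR (3.4); no measurability of the integrand is needed);
* `skeletonSecondVariationMoments : SkeletonSecondVariationMoments` with the explicit constant
  `C = 4γT · exp(3A₀ + q(3A₁ + B₁)²/(4θ) + 4θγT)`, `θ = min ε (1/(4T))`, uniform on the bath
  window `T_L, T_R ∈ [T/2, 2T]`, in the level `m`, the start `z`, `s ∈ [0, 1]` and the directions.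
After this file the open leaves below S3 are (SWM) `SkeletonWeightMoments` (R, byte-frozen),
(I-s2)ₛ and (Dˢ); (JM), (JMˣ)₁, (JMˣ)₂ are theorems.
No typeclass declarations, no new syntax, no options; no proof holes.
[cite: CuneoEckmannHairerReyBellet2018, §3 eq. (3.4)] [folklore]
-/

noncomputable section

namespace Summit.AtomisticToContinuum.FouriersLaw.Theorems.ExtensiveSnapshotIrreversibility.EnergyWindow

open MeasureTheory Filter Topology unitInterval Set
open scoped ENNReal NNReal ContDiff Real
open Literature.MathematicalPhysics.KineticTheory.HeatConduction
open Literature.Probability.Process Literature.Analysis.ODE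

/-! ## 1. Moments of the second skeleton variation at fixed `θ` -/

section Moment

variable {ω₂ lam β γ : ℝ} (hω : 0 < ω₂) (hl : 0 ≤ lam) (hβ : 0 ≤ β) (hγ : 0 ≤ γ) {N : ℕ}
  (hN : 0 < N) {T_L T_R : ℝ} (hTL : 0 < T_L) (hTR : 0 < T_R)

include hω hl hβ hγ hN hTL hTR in
/-- **Moments of the second skeleton variation along the Brownian path**, for `q ≥ 1`,
`0 < θ < 1/max(T_L, T_R)`, `s ∈ [0, 1]`, every level `m`, start `z` and directions `δ, δ'`:
`E ‖D²_Ξ X_s^{m}(z, R_m B, Ξ_m B)[δ, δ']‖^q ≤ (Amp² |δ| |δ'|)^q ·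
exp(3qA₀ + q²(3A₁ + B₁)²/(4θ) + θγ(T_L + T_R)) · e^{θ H(z)}` (V-b2 + T-a2's moment engine).
[cite: CuneoEckmannHairerReyBellet2018, §3 eq. (3.4)] -/
theorem lintegral_rpow_norm_fderiv_fderiv_skelFlowMapAt_le {q : ℝ} (hq : 1 ≤ q) {θ : ℝ}
    (hθ : 0 < θ) (hθ' : θ < 1 / max T_L T_R) {s : ℝ} (hs : s ∈ Icc (0 : ℝ) 1) (m : ℕ)
    (z : PhaseSpace N) (δ δ' : PairSkeleton m) :
    ∫⁻ wp, ENNReal.ofReal ‖fderiv ℝ (fun x => fderiv ℝ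
        (skelFlowMapAt ω₂ lam β γ N T_L T_R s m z (pairRem m wp)) x δ) (pairSkel m wp) δ'‖ ^ q
        ∂wienerPair ≤
      ENNReal.ofReal ((max |ampL ω₂ lam β γ T_L| |ampR ω₂ lam β γ T_R| ^ 2 * skelAbsSum δ *
          skelAbsSum δ') ^ q *
        (Real.exp (q * (3 * driftA₀ ω₂ γ N) +
            q ^ 2 * (3 * driftA₁ lam β N + driftB₁ ω₂ lam β N) ^ 2 / (4 * θ) +
            θ * γ * (T_L + T_R)) *
          Real.exp (θ * (pinnedChain ω₂ lam β γ).hamiltonian N z))) := by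
  have hA₀ := driftA₀_nonneg hω.le hγ N
  refine lintegral_rpow_le_of_le_mul_exp_integral hω hl hβ hγ hN hTL hTR hq hθ hθ' hs z
    (by positivity)
    (mul_nonneg (mul_nonneg (pow_nonneg (le_max_of_le_left (abs_nonneg _)) 2)
      (skelAbsSum_nonneg δ)) (skelAbsSum_nonneg δ'))
    (fun wp => norm_nonneg _) fun wp => ?_
  have h := norm_fderiv_fderiv_skelFlowMapAt_le hω hl hβ hγ N T_L T_R hs m z (pairRem m wp)
    (pairSkel m wp) δ δ'
  have hI : ∫ u in (0 : ℝ)..s, (3 * driftA₀ ω₂ γ N +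
        (3 * driftA₁ lam β N + driftB₁ ω₂ lam β N) *
          √((pinnedChain ω₂ lam β γ).hamiltonian N
            (skelFlowMapAt ω₂ lam β γ N T_L T_R u m z (pairRem m wp) (pairSkel m wp)))) =
      ∫ u in (0 : ℝ)..s, (3 * driftA₀ ω₂ γ N +
        (3 * driftA₁ lam β N + driftB₁ ω₂ lam β N) *
          √((pinnedChain ω₂ lam β γ).hamiltonian N
            ((pinnedChain ω₂ lam β γ).solMap N T_L T_R u z (pairPath wp)))) := by
    refine intervalIntegral.integral_congr fun u hu => ?_
    have hu' : u ∈ Icc (0 : ℝ) 1 := by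
      rw [uIcc_of_le hs.1] at hu
      exact ⟨hu.1, hu.2.trans hs.2⟩
    simp only [pinnedChain_solMap_eq_skelFlowMapAt hω hl hβ hγ N T_L T_R hu' m z wp]
  rw [hI] at h
  exact h

end Moment

/-! ## 2. (JMˣ)₂ -/

/-- **(JMˣ)₂ `SkeletonSecondVariationMoments` — PROVED** (`θ = min ε (1/(4T))`,
`C = 4γT · exp(3A₀ + q(3A₁ + B₁)²/(4θ) + 4θγT)`; §1 on the bath window, `Amp² ≤ 4γT`).
[folklore] [cite: CuneoEckmannHairerReyBellet2018, §3 eq. (3.4)] -/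
theorem skeletonSecondVariationMoments : SkeletonSecondVariationMoments := by
  intro ω₂ lam β γ hω hl hβ hγ T hT N hN q ε hq hε
  have hq0 : 0 ≤ q := zero_le_one.trans hq
  -- the exponential-moment parameter, valid on the whole temperature window
  set θ : ℝ := min ε (1 / (4 * T)) with hθdef
  have hθ : 0 < θ := lt_min hε (by positivity)
  have hθε : θ ≤ ε := min_le_left _ _
  have hθT : θ ≤ 1 / (4 * T) := min_le_right _ _
  clear_value θ
  set A₀ := 3 * driftA₀ ω₂ γ N with hA₀
  set A₁ := 3 * driftA₁ lam β N + driftB₁ ω₂ lam β N with hA₁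
  refine ⟨4 * γ * T * Real.exp (A₀ + q * A₁ ^ 2 / (4 * θ) + 4 * θ * γ * T), ?_⟩
  intro T_L T_R hTL1 hTL2 hTR1 hTR2 s hs0 hs1 m z δ δ'
  have hTL : 0 < T_L := by linarith
  have hTR : 0 < T_R := by linarith
  have hθ' : θ < 1 / max T_L T_R := by
    have hmax : max T_L T_R ≤ 2 * T := max_le hTL2 hTR2
    have h1 : 1 / (2 * T) ≤ 1 / max T_L T_R :=
      one_div_le_one_div_of_le (lt_max_of_lt_left hTL) hmax
    have h2 : 1 / (4 * T) < 1 / (2 * T) := one_div_lt_one_div_of_lt (by positivity) (by linarith)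
    linarith
  have hmain := lintegral_rpow_norm_fderiv_fderiv_skelFlowMapAt_le hω hl.le hβ.le hγ.le hN hTL
    hTR hq hθ hθ' ⟨hs0, hs1⟩ m z δ δ'
  refine hmain.trans (ENNReal.ofReal_le_ofReal ?_)
  rw [← hA₀, ← hA₁]
  have hH0 : 0 ≤ (pinnedChain ω₂ lam β γ).hamiltonian N z :=
    pinnedChain_hamiltonian_nonneg hω.le hl.le hβ.le γ N z
  set H := (pinnedChain ω₂ lam β γ).hamiltonian N z with hH
  have hS := skelAbsSum_nonneg δ
  have hS' := skelAbsSum_nonneg δ'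
  set S := skelAbsSum δ with hSdef
  set S' := skelAbsSum δ' with hS'def
  -- the amplitudes on the window
  have hamp : ∀ T' : ℝ, T' ≤ 2 * T →
      |Real.sqrt (2 * (pinnedChain ω₂ lam β γ).γ * T')| ≤ Real.sqrt (4 * γ * T) := by
    intro T' hT'
    rw [abs_of_nonneg (Real.sqrt_nonneg _)]
    refine Real.sqrt_le_sqrt ?_
    have hγ' : (pinnedChain ω₂ lam β γ).γ = γ := rfl
    rw [hγ']
    nlinarith [hγ.le]
  have hmax : max |ampL ω₂ lam β γ T_L| |ampR ω₂ lam β γ T_R| ≤ Real.sqrt (4 * γ * T) := by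
    show max |Real.sqrt (2 * (pinnedChain ω₂ lam β γ).γ * T_L)|
      |Real.sqrt (2 * (pinnedChain ω₂ lam β γ).γ * T_R)| ≤ _
    exact max_le (hamp T_L hTL2) (hamp T_R hTR2)
  have hmax0 : 0 ≤ max |ampL ω₂ lam β γ T_L| |ampR ω₂ lam β γ T_R| :=
    le_max_of_le_left (abs_nonneg _)
  have h4γT : 0 ≤ 4 * γ * T := by have := hγ.le; positivity
  have hsq : max |ampL ω₂ lam β γ T_L| |ampR ω₂ lam β γ T_R| ^ 2 ≤ 4 * γ * T := by
    have h := pow_le_pow_left₀ hmax0 hmax 2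
    rwa [Real.sq_sqrt h4γT] at h
  -- the three factors
  have h1 : (max |ampL ω₂ lam β γ T_L| |ampR ω₂ lam β γ T_R| ^ 2 * S * S') ^ q ≤
      (4 * γ * T * S * S') ^ q :=
    Real.rpow_le_rpow (mul_nonneg (mul_nonneg (pow_nonneg hmax0 2) hS) hS')
      (mul_le_mul_of_nonneg_right (mul_le_mul_of_nonneg_right hsq hS) hS') hq0
  have h2 : Real.exp (q * A₀ + q ^ 2 * A₁ ^ 2 / (4 * θ) + θ * γ * (T_L + T_R)) ≤
      Real.exp (A₀ + q * A₁ ^ 2 / (4 * θ) + 4 * θ * γ * T) ^ q := by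
    rw [← Real.exp_mul, Real.exp_le_exp]
    have h21 : θ * γ * (T_L + T_R) ≤ θ * γ * (4 * T) :=
      mul_le_mul_of_nonneg_left (by linarith) (mul_nonneg hθ.le hγ.le)
    have h22 : θ * γ * (4 * T) ≤ θ * γ * (4 * T) * q :=
      le_mul_of_one_le_right (by positivity) hq
    have h23 : (A₀ + q * A₁ ^ 2 / (4 * θ) + 4 * θ * γ * T) * q =
        q * A₀ + q ^ 2 * A₁ ^ 2 / (4 * θ) + θ * γ * (4 * T) * q := by ring
    linarith
  have h3 : Real.exp (θ * H) ≤ Real.exp (ε * H) ^ q := by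
    rw [← Real.exp_mul, Real.exp_le_exp]
    have h31 : θ * H ≤ ε * H := mul_le_mul_of_nonneg_right hθε hH0
    have h32 : ε * H ≤ ε * H * q := le_mul_of_one_le_right (by positivity) hq
    linarith
  have hE1 : 0 ≤ Real.exp (A₀ + q * A₁ ^ 2 / (4 * θ) + 4 * θ * γ * T) ^ q :=
    Real.rpow_nonneg (Real.exp_pos _).le q
  calc (max |ampL ω₂ lam β γ T_L| |ampR ω₂ lam β γ T_R| ^ 2 * S * S') ^ q *
        (Real.exp (q * A₀ + q ^ 2 * A₁ ^ 2 / (4 * θ) + θ * γ * (T_L + T_R)) * Real.exp (θ * H))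
      ≤ (4 * γ * T * S * S') ^ q *
          (Real.exp (A₀ + q * A₁ ^ 2 / (4 * θ) + 4 * θ * γ * T) ^ q * Real.exp (ε * H) ^ q) :=
        mul_le_mul h1 (mul_le_mul h2 h3 (Real.exp_pos _).le hE1) (by positivity)
          (Real.rpow_nonneg (mul_nonneg (mul_nonneg h4γT hS) hS') q)
    _ = (4 * γ * T * Real.exp (A₀ + q * A₁ ^ 2 / (4 * θ) + 4 * θ * γ * T) * S * S' *
          Real.exp (ε * H)) ^ q := by
        rw [← Real.mul_rpow (Real.exp_pos _).le (Real.exp_pos _).le,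
          ← Real.mul_rpow (mul_nonneg (mul_nonneg h4γT hS) hS')
            (mul_nonneg (Real.exp_pos _).le (Real.exp_pos _).le)]
        congr 1
        ring

end Summit.AtomisticToContinuum.FouriersLaw.Theorems.ExtensiveSnapshotIrreversibility.EnergyWindow

end
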